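import Summits.CriticalPhenomena.PercolationContinuityZ3.Theorems.PercNearOneGluingNoHeavyLowerTailThreePointProductFormFibreTwoTerminal
import HarnessLib

/-!
# The product form `#bad² ≤ #P1·#P2` in the fibre language: THE FLIP AROUND TWO CLUSTERS AND THE THIRD INTERFACE IDENTITY
# (Sahi programme, prover prim-sahi-p2 gen 55)

Support file (`--supports stmt-CriticalPhenomena-4575`, helper); completes `…ThreePointProductFormFibreTwoTerminal` (the two-terminal interface theorem
of the memo `run/shared/lean/prim/prim-sahi/FROM-prim-sahi-p2-gen55-REDUCTIONS.md` §0(4)).  In the TWO-TERMINAL SUBSTITUTION THEOREM (memo §0(0), §3) a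
terminal-free network `(N; x, y)` glued at a 2-cut is asked, after the flat of the whole configuration, whether `x ↔ y`; when BOTH ports lie in the
apex cluster the flat complements every label of `N` touching `C_x ∪ C_y` — the flip around TWO clusters.  In the style of
`…ThreePointCPIClusterSwapDefs.clusterFlip` (`μ_t w`: keep the labels touching the closed cluster `Q_t(w)`, complement the rest) the two-cluster flip is
`μ_{x,y} w = (keep the labels touching Q_x(w) ∪ Q_y(w), complement the rest)`, and the flip around the two OPEN clusters of `z` is `μ_{x,y} z̄`.
No definition is introduced: the statements take an arbitrary `μ : (α → Bool) → α → Bool` together with the two defining clauses (`hkeep`, `hflip`).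
* `creach_twoFlip_iff_left/right` [this work] — `μ_{x,y}` preserves BOTH closed clusters: `Q_x(μ_{x,y} w) = Q_x(w)`, `Q_y(μ_{x,y} w) = Q_y(w)`
  (closed-walk transfer `creach_transfer`; no hypothesis on whether `x, y` are joined).
* `twoFlip_twoFlip` [this work] — `μ_{x,y}` is an involution.
* **`card_filter_twoFlip_eq_card_filter_compl`** [this work] — for every class `A` depending only on the open clusters of `x` and `y` and every
  class `Y`: `#{z : A z ∧ Y (μ_{x,y} z̄)} = #{w : Y w ∧ A w̄}` (bijection `z ↦ μ_{x,y} z̄`, inverse `w ↦ (μ_{x,y} w)̄`).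
* **`card_virtual_two_eq_card_conn_not_compl`** [this work] — THE THIRD INTERFACE IDENTITY `V^{xy} = #{x ↮ y in z, x ↔ y after the flip around
  C_x ∪ C_y} = #{x ↔ y in w, x ↮ y in w̄} = Cn − A`; with `…FibreTwoTerminal` this gives `V^x = V^y = V^{xy} = Cn − A`, `V^c = A`: every count the
  substitution theorem asks of a terminal-free two-terminal network is an antithetic class size.
Standard axioms, no sorries, no named facts, no definitions.  [folklore] (walk transfer, bijection counting); [cite: Gladkov2024, Conjecture 10.1 (p. 18),
arXiv:2408.08457] for CONJECTURE (P).
-/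

namespace Summit.CriticalPhenomena.PercolationContinuityZ3.Theorems.ProductFormFibre

open Finset Literature.Probability.Percolation
open Summit.CriticalPhenomena.PercolationContinuityZ3.Theorems.ThreePointCPIClusterSwap
  (CReach QTouch creach_self creach_transfer)

variable {V α : Type*}

section TwoFlip

variable (ends : α → Sym2 V) (x y : V) (μ : (α → Bool) → α → Bool)
  (hkeep : ∀ (w : α → Bool) (l : α), (QTouch ends x w l ∨ QTouch ends y w l) → μ w l = w l)
  (hflip : ∀ (w : α → Bool) (l : α), ¬ (QTouch ends x w l ∨ QTouch ends y w l) → μ w l = !w l)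

include hkeep in
/-- **The two-cluster flip preserves the closed cluster of `x`.** [this work] -/
theorem creach_twoFlip_iff_left (w : α → Bool) (v : V) : CReach ends (μ w) x v ↔ CReach ends w x v := by
  constructor
  · rintro ⟨p⟩
    refine (creach_transfer ends x w (μ w) w ?_ p (creach_self ends x w)).1
    intro a ha ht
    rw [hkeep w a (Or.inl ht)] at ha
    exact ⟨ha, ha⟩
  · rintro ⟨p⟩
    refine (creach_transfer ends x w w (μ w) ?_ p (creach_self ends x w)).2
    intro a ha ht
    exact ⟨ha, by rw [hkeep w a (Or.inl ht)]; exact ha⟩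

include hkeep in
/-- **The two-cluster flip preserves the closed cluster of `y`.** [this work] -/
theorem creach_twoFlip_iff_right (w : α → Bool) (v : V) : CReach ends (μ w) y v ↔ CReach ends w y v := by
  constructor
  · rintro ⟨p⟩
    refine (creach_transfer ends y w (μ w) w ?_ p (creach_self ends y w)).1
    intro a ha ht
    rw [hkeep w a (Or.inr ht)] at ha
    exact ⟨ha, ha⟩
  · rintro ⟨p⟩
    refine (creach_transfer ends y w w (μ w) ?_ p (creach_self ends y w)).2
    intro a ha ht
    exact ⟨ha, by rw [hkeep w a (Or.inr ht)]; exact ha⟩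

include hkeep in
/-- The two-cluster flip preserves the set of labels touching `Q_x ∪ Q_y`. [this work] -/
theorem qtouch_twoFlip_iff (w : α → Bool) (l : α) :
    (QTouch ends x (μ w) l ∨ QTouch ends y (μ w) l) ↔ (QTouch ends x w l ∨ QTouch ends y w l) := by
  simp only [QTouch, creach_twoFlip_iff_left ends x y μ hkeep w, creach_twoFlip_iff_right ends x y μ hkeep w]

include hkeep hflip in
/-- **`μ_{x,y}` is an involution.** [this work] -/
theorem twoFlip_twoFlip (w : α → Bool) : μ (μ w) = w := by
  funext l
  by_cases h : QTouch ends x w l ∨ QTouch ends y w l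
  · rw [hkeep (μ w) l ((qtouch_twoFlip_iff ends x y μ hkeep w l).2 h), hkeep w l h]
  · rw [hflip (μ w) l (fun h' => h ((qtouch_twoFlip_iff ends x y μ hkeep w l).1 h')), hflip w l h, Bool.not_not]

include hkeep in
/-- The open clusters of `x` (and of `y`) in the complement of `μ_{x,y} z̄` are those of `z`. [this work] -/
theorem reachable_compl_twoFlip_iff (z : α → Bool) (v : V) :
    ((openGraph (labelledOpen ends fun l => !(μ (fun l' => !z l')) l)).Reachable x v ↔
        (openGraph (labelledOpen ends z)).Reachable x v) ∧
    ((openGraph (labelledOpen ends fun l => !(μ (fun l' => !z l')) l)).Reachable y v ↔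
        (openGraph (labelledOpen ends z)).Reachable y v) := by
  have hx := creach_twoFlip_iff_left ends x y μ hkeep (fun l' => !z l') v
  have hy := creach_twoFlip_iff_right ends x y μ hkeep (fun l' => !z l') v
  simp only [CReach, Bool.not_not] at hx hy
  exact ⟨hx, hy⟩

variable [Fintype α] [DecidableEq α]

include hkeep hflip in
/-- **Two-cluster-flip transitions out of a two-cluster class are complement transitions.**  If `A` depends only on the open clusters of `x`
and `y`, then for every class `Y`: `#{z : A z ∧ Y (μ_{x,y} z̄)} = #{w : Y w ∧ A w̄}` — bijection `z ↦ μ_{x,y} z̄`, inverse `w ↦ (μ_{x,y} w)̄`. [this work] -/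
theorem card_filter_twoFlip_eq_card_filter_compl (A Y : (α → Bool) → Prop) [DecidablePred A] [DecidablePred Y]
    (hA : ∀ z z' : α → Bool,
      (∀ v, ((openGraph (labelledOpen ends z)).Reachable x v ↔ (openGraph (labelledOpen ends z')).Reachable x v) ∧
        ((openGraph (labelledOpen ends z)).Reachable y v ↔ (openGraph (labelledOpen ends z')).Reachable y v)) → (A z ↔ A z')) :
    (univ.filter fun z : α → Bool => A z ∧ Y (μ fun l => !z l)).card =
    (univ.filter fun w : α → Bool => Y w ∧ A (fun l => !w l)).card := by
  refine Finset.card_bij' (fun z _ => μ fun l => !z l) (fun w _ => fun l => !(μ w) l) ?_ ?_ ?_ ?_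
  · intro z hz
    rw [Finset.mem_filter] at hz ⊢
    exact ⟨Finset.mem_univ _, hz.2.2, (hA _ _ (fun v => reachable_compl_twoFlip_iff ends x y μ hkeep z v)).2 hz.2.1⟩
  · intro w hw
    rw [Finset.mem_filter] at hw ⊢
    have hww : (fun l' => !(fun l => !(μ w) l) l') = μ w := by funext l; simp only [Bool.not_not]
    refine ⟨Finset.mem_univ _, ?_, ?_⟩
    · refine (hA (fun l => !(μ w) l) (fun l => !w l) (fun v => ?_)).2 hw.2.2
      have h := reachable_compl_twoFlip_iff ends x y μ hkeep (fun l => !(μ w) l) v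
      rw [hww, twoFlip_twoFlip ends x y μ hkeep hflip w] at h
      exact ⟨h.1.symm, h.2.symm⟩
    · rw [hww, twoFlip_twoFlip ends x y μ hkeep hflip w]
      exact hw.2.1
  · intro z _
    rw [twoFlip_twoFlip ends x y μ hkeep hflip (fun l => !z l)]
    funext l; simp only [Bool.not_not]
  · intro w _
    have hww : (fun l' => !(fun l => !(μ w) l) l') = μ w := by funext l; simp only [Bool.not_not]
    rw [hww, twoFlip_twoFlip ends x y μ hkeep hflip w]

include hkeep hflip in
open Classical in
/-- **THE THIRD INTERFACE IDENTITY `V^{xy} = Cn − A`.**  The configurations with `x ↮ y` in which `x ↔ y` after the flip around the two open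
clusters `C_x ∪ C_y` (`μ_{x,y} z̄`: complement every label touching `C_x(z) ∪ C_y(z)`) are equinumerous with those in which `x ↔ y` in `w` and
`x ↮ y` in the complement `w̄`.  With `card_virtual_eq_card_conn_not_compl` (`…FibreTwoTerminal`): `V^x = V^y = V^{xy} = Cn − A`. [this work] -/
theorem card_virtual_two_eq_card_conn_not_compl :
    (univ.filter fun z : α → Bool => ¬ (openGraph (labelledOpen ends z)).Reachable x y ∧
        (openGraph (labelledOpen ends (μ fun l => !z l))).Reachable x y).card =
    (univ.filter fun w : α → Bool => (openGraph (labelledOpen ends w)).Reachable x y ∧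
        ¬ (openGraph (labelledOpen ends fun l => !w l)).Reachable x y).card :=
  card_filter_twoFlip_eq_card_filter_compl ends x y μ hkeep hflip
    (fun z => ¬ (openGraph (labelledOpen ends z)).Reachable x y)
    (fun z => (openGraph (labelledOpen ends z)).Reachable x y)
    (fun _ _ h => not_congr (h y).1)

end TwoFlip

end Summit.CriticalPhenomena.PercolationContinuityZ3.Theorems.ProductFormFibre
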